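import Literature.NumberTheory.Automorphic.Liu2021.AppendixC.PropC5
import Literature.NumberTheory.Automorphic.Liu2021.Thm418AsPrinted
import Literature.AlgebraicGeometry.Motives.AbelianVariety
import Mathlib.CategoryTheory.Preadditive.Basic
import Mathlib.Topology.Algebra.OpenSubgroup
import HarnessLib

/-!
# Liu 2021, Appendix C → Theorem 4.18: the glue (Def. C.6, Def. C.8, §4.2 l. 2053–2074), EXACTLY AS PRINTED
# (statement-exact typing; no proof)

[Liu2021] = Yifeng Liu, *Fourier–Jacobi cycles and arithmetic relative trace formula*, Cambridge J. Math. **9** (2021),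
no. 1, 1–147 = arXiv:2102.11518.  PRIMARY SOURCE READ FOR THIS FILE: the author's TeX source of the arXiv v2 e-print,
`FJcycle.tex` (md5 `6db49a74122d2cb0f224fa1b39488a0c`, 7163 lines; held at
`run/shared/lean/pub/pub-hodgecm/pub-hodgecm-cf-kudla-howe-rallis-g4/lit/Liu21-arxiv-src/FJcycle.tex`) — every `l. NNNN`
below is a line of that file.  Appendix C's numbering (one counter shared by all environments): C.1 = Def. l. 4565, C.2 =
Rem. l. 4602, C.3 = Def. l. 4614, C.4 = Def. l. 4620, C.5 = Prop. l. 4627, C.6 = Def. l. 4640, C.7 = Rem. l. 4644, C.8 =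
Def. l. 4663, C.9 = Rem. l. 4667.  Cambridge J. Math. page numbers are not held (acquisition `acq-07613`) and are not quoted.

## What this file is (coordinator ruling 2026-08-21T16:13:55Z, «[Liu 2021] APPENDIX C AS PRINTED, split across four typers»)

This is typer 4's file, the GLUE: how Appendix C feeds the hypotheses — more precisely the DATA — of Theorem 4.18 as typed
in `Liu2021/Thm418AsPrinted.lean` (`Thm418Data`, `Thm418AsPrinted`; p277833).  Appendix C supplies no printed CONDITION
of Thm. 4.18; it supplies the MEANING of its carriers: `𝕍` (Def. C.3), `G = 𝔾(𝔸_F^∞)` (l. 4618, l. 2060), and — through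
Prop. C.5 / Def. C.6 (the Shimura varieties `Sh(𝕍)_K`), l. 4656–4660 / Def. C.8 (the compactified Shimura varieties
`X_K = \widetilde{Sh}(𝕍)_K`) and §4.2 l. 2066–2074 with §2.1 Def. 2.1 / Def. 2.3 (the Albanese varieties `A_K = Alb_{X_K}`,
`A_∞ = lim_K A_K`) — the groups `Hom_E(A_K, A_μ)_ℚ` of item (1) and the maps `Hom_E(A_K, A_μ)_ℚ → Ω(μ)`.  The sibling files
are `AppendixC/PropC5.lean` (typer 3: Prop. C.5 over its datum `PropC5Data` — `𝕍`, `𝔾(𝔸_F^∞)`, the fixed `V(τ)`, `G(τ)`,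
the fixed isomorphisms `𝔾(𝔸_F^∞) ≃ G(τ)(𝔸^∞)` of l. 4624, the systems `Sh(G(τ), h_{V(τ),τ'})_K` of §C.1 / Rem. C.2 — p291448),
`AppendixC/DefC1toC3.lean` (typer 1: hermitian spaces, Def. C.1–C.3) and `AppendixC/DefC4.lean` (typer 2: Def. C.4); this
file imports `PropC5` and `Thm418AsPrinted` only, and `AppendixC/GlueHermitian.lean` (typer 4, later) instantiates
`PropC5Data`'s tokens `𝕍`, `V τ` on typer 1/2's structures (import graph: `HOME/liuC/NAMES.md`).

## What a CARRIER is

As in `Thm418AsPrinted.lean` and `PropC5.lean`: an object the printed text NAMES but Mathlib / the tree cannot construct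
(Baily–Borel compactifications, blow-ups, `∇X`, the Albanese variety as a corepresenting object, the pro-object `A_∞`, …)
is a field marked **⟨CARRIER⟩**, whose docstring quotes the printed DEFINITION with its TeX line; every printed ATTRIBUTE of
a carrier that a later sentence uses is a `Prop`/data FIELD typed on real Mathlib / tree vocabulary (`SchemeOver`,
`SmoothOfRelativeDimension`, `IsProjectiveOver`, `IsOpenImmersion`, tree `Motives.AbelianVariety` and its additive
`Hom`-groups).  NOTHING IS ASSERTED: the structures are data a consumer supplies; the `Prop`-valued definitions are
predicates on them.  What is REAL here: the abelian varieties `A_K` (tree `Motives.AbelianVariety E`), the groups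
`Hom_E(A_K, B)_ℚ := ℚ ⊗_ℤ Hom_E(A_K, B)` and their pull-backs, the index posets of levels, the base-change functors.

## The printed text (verbatim from `FJcycle.tex`, TeX macros resolved: `\bV` = `𝕍`, `\bG` = `𝔾`, `\bA` = `𝔸`, `\Sh` = `Sh`,
`\widetilde\Sh` = `S̃h`, `\ol\Sh` = `\overline{Sh}`, `\Alb` = `Alb`)

**Def. 2.1** (TeX label `de:split`, l. 1171–1184): «Consider schemes `X, Y ∈ Sch_{/k}` of finite type. (1) We denote by
`∇X` the smallest open and closed subscheme of `X × X` containing the diagonal `ΔX`. For every morphism `u : Y → X`, `u × u`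
restricts to a morphism `∇u : ∇Y → ∇X`. […]»

**Proposition** (unnumbered, l. 1190–1192): «Let `X` be a proper smooth scheme in `Sch_{/k}`. Consider the functor
`\underline{Alb}_X` on the category of abelian varieties `A` over `k` such that `\underline{Alb}_X(A)` is the set of morphisms
`f : ∇X → A` over `k` such that `ΔX` is contained in `f^{-1} 0_A`. Then `\underline{Alb}_X` is corepresentable.» (Proof,
l. 1194–1200: Serre's construction [Ser59], [Wit08, App. A] over a separable closure, then Galois descent.)

**Def. 2.3** (TeX label `de:albanese`, l. 1202–1208): «Let `X` be a proper smooth scheme in `Sch_{/k}`. The abelian variety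
that corepresents the functor `\underline{Alb}_X` is called the *Albanese variety* of `X`, denoted by `Alb_X`. The canonical
morphism, denoted by `α_X : ∇X → Alb_X`, is called the *Albanese morphism*. For a morphism `u : Y → X` of proper smooth
schemes over `k`, we have the induced morphism `Alb_u : Alb_Y → Alb_X` by the universal property, which satisfies
`Alb_u ∘ α_X = α_Y ∘ ∇u`.»  [SIC: with `α_X : ∇X → Alb_X`, `α_Y : ∇Y → Alb_Y`, `∇u : ∇Y → ∇X`, `Alb_u : Alb_Y → Alb_X`, the
composable identity is `Alb_u ∘ α_Y = α_X ∘ ∇u : ∇Y → Alb_X`; this file types the composable identity — READING G3.]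

**§4.2 «Albanese of unitary Shimura varieties»** (TeX label `ss:albanese_unitary`), l. 2053–2074: «Let `n ≥ 2` be an
integer. Let `𝕍` be a totally definite incoherent hermitian space over `𝔸_E` of rank `n` (Definition C.3). We distinguish
between two cases: [Noncompact Case] `d = 1`, and either `n ≥ 3` or `n = 2` and the hermitian space `𝕍 ⊗_𝔸 ℚ_p` is
isotropic for every rational prime `p`. [Compact Case] if it is not in the Noncompact Case.  Let `𝔾 := U(𝕍)` be the
unitary group of `𝕍`, which is a reductive group over `𝔸_F`. Let `{Sh(𝕍)_K}_K` be the projective system of Shimura varieties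
for `𝕍` indexed by sufficiently small open compact subgroups `K` of `𝔾(𝔸_F^∞)` (Definition C.6). Every scheme `Sh(𝕍)_K` is
smooth, quasi-projective, and of dimension `n − 1` over `E`; it is projective if and only if we are in the Compact Case. In
all cases, we have the compactified Shimura variety `S̃h(𝕍)_K` (Definition C.8). Put `X_K := S̃h(𝕍)_K` for short. Then
`{X_K}_K` is a projective system of smooth projective schemes in `Sch_{/E}` of dimension `n − 1`. For `K' ⊆ K`, we denote
the transition morphism by `u^{K'}_K : X_{K'} → X_K`, which is a generically finite dominant morphism. Put
`X_∞ := lim_K X_K`.  We denote by `A_K` the Albanese variety `Alb_{X_K}` of `X_K` (Definition 2.3) for short, and by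
`α_K := α_{X_K} : ∇X_K → A_K` (display `eq:albanese_shimura`) the Albanese morphism (see Definition 2.1 for the meaning of `∇`). By functoriality, we
obtain a projective system `{A_K}_K`. Put `A_∞ := lim_K A_K`, which is an abelian group pro-object in `Sch_{/E}`. Then the
Hecke correspondences provide a homomorphism `𝔾(𝔸_F^∞) → Aut_E(A_∞)`.»  (`d` = the degree of `F`, l. 1878.)

**App. C, l. 4624**: «It is clear that for every `τ ∈ Φ_F`, there exists a hermitian space that is `τ`-nearby to `𝕍`,
unique up to isomorphism. We fix such a space `V(τ)`. Put `G(τ) := Res_{F/ℚ} U(V(τ))`. We fix an isomorphism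
`𝕍 ⊗_{𝔸_F} 𝔸_F^∞ ≃ V(τ) ⊗_F 𝔸_F^∞`, hence an isomorphism `𝔾(𝔸_F^∞) ≃ G(τ)(𝔸^∞)`.» — typed by `PropC5Data` (typer 3).
**Prop. C.5** (l. 4627–4633): «There is a projective system of schemes `{Sh(𝕍)_K}_K` over `E` indexed by sufficiently small
open compact subgroups `K` of `𝔾(𝔸_F^∞)`, such that for every `τ ∈ Φ_F` and every `τ' ∈ Φ_E` above it, we have an
isomorphism `{Sh(𝕍)_K ⊗_{E,τ'} τ'(E)}_K ≃ {Sh(G(τ), h_{V(τ),τ'})_K}_K` of projective systems of schemes over `τ'(E)`. Here,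
we use the fixed isomorphism `𝔾(𝔸_F^∞) ≃ G(τ)(𝔸^∞)` to regard `K` as a subgroup of `G(τ)(𝔸^∞)`.» — typed by
`PropC5AsPrinted` (typer 3), an existential.
**Def. C.6** (TeX label `de:shimura_incoherent`, l. 4640–4642): «We call the projective system of schemes `{Sh(𝕍)_K}_K`
over `E` in Proposition C.5 the *Shimura varieties associated to `𝕍`*.»
**Rem. C.7** (l. 4644–4654): «One can also interpret Proposition C.5 in the following way: The scheme
`∏_{τ ∈ Φ_F} ∏_{τ' ∈ π^{-1}τ} Sh(G(τ), h_{V(τ),τ'})_K` over `∏_{τ ∈ Φ_F} ∏_{τ' ∈ π^{-1}τ} Spec τ'(E) = ∏_{τ' ∈ Φ_E} Spec τ'(E)`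
descends to a scheme `Sh(𝕍)_K` over `Spec E`, where the above fiber products are taken over `Spec ℚ`.» — NOT TYPED
(an interpretation, not used later).
**l. 4656–4660**: «The scheme `Sh(𝕍)_K` (for `K` sufficiently small) is quasi-projective and smooth over `E` of dimension
`n − 1`. It is projective if `d > 1` or `n = 1`. In all cases, we denote by `\overline{Sh}(𝕍)_K` the Baily–Borel
compactification of `Sh(𝕍)_K` over `E`. Then `\overline{Sh}(𝕍)_K ∖ Sh(𝕍)_K` is either empty or consists of isolated singular
points. Let `S̃h(𝕍)_K` be the blow-up of `\overline{Sh}(𝕍)_K` along `\overline{Sh}(𝕍)_K ∖ Sh(𝕍)_K`. If `Sh(𝕍)_K` is proper, then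
`S̃h(𝕍)_K = Sh(𝕍)_K`. Otherwise, we must have `d = 1`, that is, `F = ℚ`. In this case, there is only one choice for `τ ∈ Φ_F`,
for which we will suppress from various notation like `V(τ)`, `G(τ)`, etc. However, there are still two choices of `Φ`,
say, `{τ^+}` and `{τ^−}`. We have isomorphisms (C.3) `S̃h(𝕍)_K ⊗_{E,τ^±} τ^±(E) ≃ S̃h(G, h_{V,τ^±})_K` extending those in
Proposition C.5. Here, `S̃h(G, h_{V,τ^±})_K` is the unique toroidal compactification of `Sh(G, h_{V,τ^±})_K` over `E`
[AMRT, Pin90].»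
**Def. C.8** (TeX label `de:shimura_incoherent_toroidal`, l. 4663–4665): «We call the projective system of schemes
`{S̃h(𝕍)_K}_K` over `E` the *compactified Shimura varieties associated to `𝕍`* (even when `Sh(𝕍)_K` is already proper).»
**Rem. C.9** (l. 4667–4669): «The boundary `S̃h(𝕍)_K ∖ Sh(𝕍)_K` is a smooth divisor.» — NOT TYPED (not used later).

## The typing (paper order)

* Levels.  «sufficiently small open compact subgroups `K` of `𝔾(𝔸_F^∞)`» = typer 3's `C5.SmallLevel K₀` (the open compact
  `K ⊆ K₀` for a threshold `K₀`, READING R2 of `Thm418AsPrinted`), a poset, hence a category; «projective system indexed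
  by …» = a functor out of it (`K' ⊆ K ↦ (X_{K'} → X_K)`), as in `PropC5AsPrinted`.
* **Def. C.6** — `IncoherentShimuraSystem D`: a WITNESS of the existential `PropC5AsPrinted D` (the system `Sh𝕍` over `E`
  with its threshold `K₀` AND the printed isomorphisms `iso τ τ'` as data); `propC5AsPrinted_iff : PropC5AsPrinted D ↔
  Nonempty (IncoherentShimuraSystem D)`.  Def. C.6 speaks of «the» system of Prop. C.5: the consumer's witness.
* **l. 4656–4660, Def. C.8** — `CompactifiedSystem S`: ⟨CARRIER⟩ `ShBar K` (Baily–Borel), the open immersion `jBar K`, the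
  discreteness of the boundary («either empty or consists of isolated […] points»; «singular» NOT TYPED), ⟨CARRIER⟩ the system
  `X : C5.SmallLevel S.K₀ ⥤ SchemeOver E` of the `X_K = S̃h(𝕍)_K` with ⟨CARRIER⟩ blow-down maps `X_K → \overline{Sh}(𝕍)_K` and the
  open immersions `j : Sh𝕍 ⟶ X` (a natural transformation: compatible with the transition maps), «if `Sh(𝕍)_K` is proper,
  then `S̃h(𝕍)_K = Sh(𝕍)_K`» (`j.app K` is an isomorphism), «smooth … of dimension `n − 1`» (Mathlib
  `SmoothOfRelativeDimension (n-1)`), «projective if `d > 1` or `n = 1`» and «`{X_K}_K` … smooth projective … of dimension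
  `n − 1`» (tree `Motives.IsProjectiveOver`).  NOT TYPED: «quasi-projective» (no such notion in Mathlib), «blow-up» beyond
  the carrier and its two printed consequences, the isomorphisms (C.3) with the toroidal compactifications in the case `d = 1`
  (they concern `F = ℚ` only and no hypothesis of Thm. 4.18 uses them), Rem. C.7, Rem. C.9.
* **Def. 2.1 (1)** — `Nabla X` (⟨CARRIER⟩ `∇X` with its clopen inclusion into `X × X`, the factorisation of the diagonal,
  minimality); **Def. 2.3 with the Proposition** — `Albanese X`: REAL abelian variety `Alb` over `k`, `α : ∇X → Alb`,
  «`ΔX ⊆ α^{-1} 0_A`» read as `ΔX ≫ α = 0` (READING G0: the zero `X`-valued point; for the smooth, hence reduced, `X` of the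
  text the set- and scheme-theoretic containments agree), corepresentability as `desc`/`fac`/`uniq`.  Existence is NOT
  claimed (the consumer supplies the datum).
* **§4.2 l. 2053–2074** — `Sec42Data P5 isotropicAt`, over the parameters `P5 : PropC5Data F E` (the `𝕍`, `𝔾(𝔸_F^∞)`, nearby
  data of App. C) and ⟨CARRIER⟩ `isotropicAt p` («`𝕍 ⊗_𝔸 ℚ_p` is isotropic», the only place the text looks inside `𝕍`; both
  instantiated on typer 1/2's hermitian structures in `GlueHermitian.lean`): `2 ≤ n`, the witness `S` (Def. C.6), «projective if and only if we are in the Compact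
  Case», the compactified system `cpt` (Def. C.8), the Albanese data `alb K` of every `X_K`, ⟨CARRIER⟩ `∇u^{K'}_K` with its
  defining property, and `Alb_{u^{K'}_K}` with the printed identity (READING G3) and functoriality («we obtain a projective
  system `{A_K}_K`»).  NOT TYPED: `X_∞`; «generically finite dominant»; the pro-object `A_∞` as an object (only its
  defining system `albFunctor`); the Hecke homomorphism `𝔾(𝔸_F^∞) → Aut_E(A_∞)` (l. 2074 prints no formula — the action it
  induces on `Ω(μ)` is the carrier `rhoΩ` of `Thm418Data`, kept as such).
* **The bridge** — `Sec42Data.HomQ C K B := ℚ ⊗_ℤ Hom_E(A_K, B)` (REAL; the `E`-RATIONAL Hom group of item (1), l. 2239);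
  `Thm418Rest C` = the fields of `Thm418Data` NOT coming from Appendix C (`Eps`, `epsOf`, `Chi`, the REAL `μ` with its two
  printed hypotheses, `Obj` now with the first component `A_μ` of `D_μ = (A_μ, i_μ, λ_μ, r_μ)` as a REAL abelian variety over
  `E` — Def. 4.5 (2) first bullet, l. 1944 —, `ω`, `ρ`, `Ω(μ)`, `ρ_Ω`, and the maps `res K D_μ : Hom_E(A_K, A_μ)_ℚ → Ω(μ)` with
  their compatibility with pull-back along `Alb_{u^{K'}_K}` — READING G2: the printed map is
  `Hom_E(A_K, A_μ)_ℚ → Hom_E(A_∞, A_μ)_ℚ = colim_K Hom_E(A_K, A_μ)_ℚ → Ω(μ)`); `toThm418Data C R : Thm418Data F E` sets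
  `𝕍 := P5.𝕍`, `G := P5.G = 𝔾(𝔸_F^∞)`, `HomK K D_μ := HomQ (levelOf K) (A_μ D_μ)` where `levelOf K = K` for the sufficiently
  small open compact `K` the statement quantifies over (`coe_levelOf`; other `K` are sent to `K ⊓ K₀` / `K₀`, values the
  statement never uses), and copies the rest; `Thm418AsPrintedC C R := Thm418AsPrinted (toThm418Data C R)`.

READINGS G0, G2, G3 and typer 3's R2–R4 are the only interpretive choices.  No hypothesis of Thm. 4.18 is added or removed
by presenting its datum through Appendix C.  T5: n/a (no theorem with hypothesis binders beyond unfolding lemmas).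

## References

* [Liu2021] Y. Liu, *Fourier–Jacobi cycles and arithmetic relative trace formula*, Camb. J. Math. 9 (2021) 1–147,
  arXiv:2102.11518 — §2.1 Def. 2.1 (l. 1171–1184), Proposition and Def. 2.3 (l. 1190–1208); §4.2 l. 2053–2074; App. C
  l. 4618–4624, Prop. C.5 (l. 4627–4637), Def. C.6 (l. 4640–4642), Rem. C.7, l. 4656–4660, Def. C.8 (l. 4663–4665), Rem. C.9.
-/

noncomputable section

open CategoryTheory AlgebraicGeometry MonoidalCategory CartesianMonoidalCategory NumberField
open scoped TensorProduct
open Literature.AlgebraicGeometry.Motives (SchemeOver AbelianVariety IsProjectiveOver)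

namespace Literature.NumberTheory.Automorphic.Liu2021.AppendixC

/-! ## Def. C.6: the Shimura varieties associated to `𝕍` — a witness of Prop. C.5 -/

section DefC6

variable {F E : Type} [Field F] [NumberField F] [IsTotallyReal F] [Field E] [NumberField E] [Algebra F E]
  [IsTotallyComplex E] [Algebra.IsQuadraticExtension F E]

/-- **The Shimura varieties associated to `𝕍`** (Def. C.6, l. 4640–4642: «We call the projective system of schemes
`{Sh(𝕍)_K}_K` over `E` in Proposition C.5 the *Shimura varieties associated to `𝕍`*.»): a WITNESS of the existential statement
`PropC5AsPrinted D` (l. 4627–4633) — a threshold `K₀` («sufficiently small», READING R2), ⟨CARRIER⟩ the projective system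
`Sh𝕍 : K ↦ Sh(𝕍)_K` of `E`-schemes on the open compact `K ⊆ K₀`, and, as DATA, for every `τ ∈ Φ_F` and every `τ' ∈ Φ_E` above
it the printed isomorphism of projective systems over `τ'(E)`, `{Sh(𝕍)_K ⊗_{E,τ'} τ'(E)}_K ≃ {Sh(G(τ), h_{V(τ),τ'})_K}_K`, `K`
regarded in `G(τ)(𝔸^∞)` through the fixed isomorphism `D.fix τ` (typer 3's READINGS R3, R4).  `propC5AsPrinted_iff`: Prop. C.5
holds for `D` iff such a witness exists. [cite: Liu2021, Def. C.6 (l. 4640–4642) and Prop. C.5 (l. 4627–4633)] -/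
structure IncoherentShimuraSystem (D : PropC5Data F E) : Type 1 where
  /-- The threshold: «sufficiently small open compact subgroups `K` of `𝔾(𝔸_F^∞)`» are the open compact `K ⊆ K₀` (READING R2). -/
  K₀ : C5.OpenCompactSubgroup D.G
  /-- ⟨CARRIER⟩ «a projective system of schemes `{Sh(𝕍)_K}_K` over `E` indexed by sufficiently small open compact subgroups `K`
  of `𝔾(𝔸_F^∞)`» (l. 4627–4628). -/
  Sh𝕍 : C5.SmallLevel K₀ ⥤ SchemeOver E
  /-- «for every `τ ∈ Φ_F` and every `τ' ∈ Φ_E` above it, we have an isomorphism `{Sh(𝕍)_K ⊗_{E,τ'} τ'(E)}_K ≃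
  {Sh(G(τ), h_{V(τ),τ'})_K}_K` of projective systems of schemes over `τ'(E)`. Here, we use the fixed isomorphism
  `𝔾(𝔸_F^∞) ≃ G(τ)(𝔸^∞)` to regard `K` as a subgroup of `G(τ)(𝔸^∞)`» (l. 4628–4632), as data. -/
  iso : ∀ (τ : F →+* ℝ) (τ' : E →+* ℂ), C5.IsAbove τ τ' →
    ((Sh𝕍 ⋙ C5.baseChangeAlong τ'.rangeRestrictField) ≅ (C5.SmallLevel.transport (D.fix τ) K₀ ⋙ D.Sh τ τ'))

/-- Prop. C.5 holds for the datum `D` iff a system of Shimura varieties associated to `𝕍` (Def. C.6, with its printed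
isomorphisms) exists.  Unfolding, ours. [cite: Liu2021, Prop. C.5 and Def. C.6] -/
theorem propC5AsPrinted_iff (D : PropC5Data F E) : PropC5AsPrinted D ↔ Nonempty (IncoherentShimuraSystem D) := by
  constructor
  · rintro ⟨K₀, Sh, h⟩
    exact ⟨⟨K₀, Sh, fun τ τ' hτ => (h τ τ' hτ).some⟩⟩
  · rintro ⟨S⟩
    exact ⟨S.K₀, S.Sh𝕍, fun τ τ' hτ => ⟨S.iso τ τ' hτ⟩⟩

/-- A chosen system of Shimura varieties associated to `𝕍` from Prop. C.5 (choice; Def. C.6 «the projective system … in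
Proposition C.5»). [cite: Liu2021, Def. C.6] -/
def IncoherentShimuraSystem.ofPropC5 {D : PropC5Data F E} (h : PropC5AsPrinted D) : IncoherentShimuraSystem D :=
  Classical.choice ((propC5AsPrinted_iff D).1 h)

end DefC6

/-! ## §2.1: `∇X` (Def. 2.1 (1)) and the Albanese variety (Def. 2.3), as printed -/

section Albanese

universe u

variable {k : Type u} [Field k]

open scoped MonObj

/-- **`∇X`** (Def. 2.1 (1), l. 1174: «We denote by `∇X` the smallest open and closed subscheme of `X × X` containing the diagonal
`ΔX`.»)  ⟨CARRIER⟩ with its printed properties as fields: the subscheme `N` with its inclusion `incl` into `X × X` (`X ⊗ X` in the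
cartesian monoidal category `SchemeOver k = Over (Spec k)`), an open and a closed immersion; the diagonal `ΔX = lift (𝟙 X) (𝟙 X)`
factors through it (`diag`); minimality among the open and closed subschemes of `X × X` through which the diagonal factors.
Mathlib has connected components of topological spaces but no «smallest open and closed subscheme containing» construction on
schemes; hence a carrier. [cite: Liu2021, Def. 2.1 (1), l. 1171–1174] -/
structure Nabla (X : SchemeOver k) where
  /-- ⟨CARRIER⟩ the scheme `∇X` over `k`. -/
  N : SchemeOver k
  /-- ⟨CARRIER⟩ the inclusion `∇X ↪ X × X`. -/
  incl : N ⟶ X ⊗ X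
  /-- «open … subscheme» (l. 1174). -/
  isOpenImmersion_incl : IsOpenImmersion incl.left
  /-- «… and closed subscheme» (l. 1174). -/
  isClosedImmersion_incl : IsClosedImmersion incl.left
  /-- ⟨CARRIER⟩ «containing the diagonal `ΔX`» (l. 1174): the diagonal factors through `∇X`. -/
  diag : X ⟶ N
  /-- The factorisation is of the diagonal `ΔX : X → X × X`. -/
  diag_incl : diag ≫ incl = lift (𝟙 X) (𝟙 X)
  /-- «the smallest» (l. 1174): every open and closed subscheme `j : W ↪ X × X` through which the diagonal factors contains `∇X`. -/
  minimal : ∀ (W : SchemeOver k) (j : W ⟶ X ⊗ X), IsOpenImmersion j.left → IsClosedImmersion j.left →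
    (∃ δ : X ⟶ W, δ ≫ j = lift (𝟙 X) (𝟙 X)) → ∃ f : N ⟶ W, f ≫ j = incl

/-- **The Albanese variety `Alb_X` with its Albanese morphism `α_X : ∇X → Alb_X`** (Def. 2.3, l. 1202–1206, with the Proposition
before it, l. 1190–1192): «Let `X` be a proper smooth scheme in `Sch_{/k}`. Consider the functor `\underline{Alb}_X` on the category
of abelian varieties `A` over `k` such that `\underline{Alb}_X(A)` is the set of morphisms `f : ∇X → A` over `k` such that `ΔX` is
contained in `f^{-1} 0_A`. Then `\underline{Alb}_X` is corepresentable.» — «The abelian variety that corepresents the functor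
`\underline{Alb}_X` is called the *Albanese variety* of `X`, denoted by `Alb_X`. The canonical morphism, denoted by
`α_X : ∇X → Alb_X`, is called the *Albanese morphism*.»  TYPED as the corepresenting datum: a REAL abelian variety `Alb` over `k`
(tree `Motives.AbelianVariety`), a `∇X` (`Nabla X`), the morphism `α`, the condition «`ΔX ⊆ α^{-1} 0_A`» read as `ΔX ≫ α = 0_A`
(the unit, written `1`, of Mathlib's group `Hom_k(X, Alb)` of `X`-valued points; READING G0), and corepresentability as
`desc`/`fac`/`uniq` in the style of Mathlib's `IsColimit` (the factorisation is data).  Existence (the Proposition) is NOT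
claimed. [cite: Liu2021, Def. 2.3 and the Proposition before it, l. 1190–1206] -/
structure Albanese (X : SchemeOver k) where
  /-- `∇X` (Def. 2.1 (1)). -/
  nabla : Nabla X
  /-- `Alb_X`, an abelian variety over `k` (REAL: tree `Motives.AbelianVariety k`). -/
  Alb : AbelianVariety k
  /-- The Albanese morphism `α_X : ∇X → Alb_X` (l. 1205). -/
  α : nabla.N ⟶ Alb.X
  /-- «`ΔX` is contained in `α^{-1} 0_A`» (l. 1191): `ΔX ≫ α_X` is the zero `X`-valued point (READING G0). -/
  diag_α : nabla.diag ≫ α = 1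
  /-- Corepresentability (l. 1191–1192, 1203): every `f : ∇X → A` with `ΔX ⊆ f^{-1} 0_A` factors through `α_X` by a homomorphism
  `Alb_X → A` … -/
  desc : ∀ {A : AbelianVariety k} (f : nabla.N ⟶ A.X), nabla.diag ≫ f = 1 → (Alb ⟶ A)
  /-- … with `f = desc f ∘ α_X` … -/
  fac : ∀ {A : AbelianVariety k} (f : nabla.N ⟶ A.X) (hf : nabla.diag ≫ f = 1), α ≫ (desc f hf).hom.hom.hom = f
  /-- … uniquely. -/
  uniq : ∀ {A : AbelianVariety k} (f : nabla.N ⟶ A.X) (hf : nabla.diag ≫ f = 1) (ψ : Alb ⟶ A),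
    α ≫ ψ.hom.hom.hom = f → ψ = desc f hf

/-- Two homomorphisms `Alb_X → A` that agree after composition with the Albanese morphism are equal (uniqueness half of the
corepresentability, l. 1191–1192).  Ours, from `uniq`. [cite: Liu2021, Def. 2.3] -/
theorem Albanese.hom_ext {X : SchemeOver k} (a : Albanese X) {A : AbelianVariety k} (ψ ψ' : a.Alb ⟶ A)
    (h : a.α ≫ ψ.hom.hom.hom = a.α ≫ ψ'.hom.hom.hom) : ψ = ψ' := by
  have hf : a.nabla.diag ≫ (a.α ≫ ψ'.hom.hom.hom) = 1 := by
    rw [← Category.assoc, a.diag_α, MonObj.one_comp]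
  exact (a.uniq _ hf ψ h).trans (a.uniq _ hf ψ' rfl).symm

end Albanese

/-! ## App. C l. 4656–4660 and Def. C.8: the compactified Shimura varieties `X_K = S̃h(𝕍)_K` (carriers) -/

section DefC8

variable {F E : Type} [Field F] [NumberField F] [IsTotallyReal F] [Field E] [NumberField E] [Algebra F E]
  [IsTotallyComplex E] [Algebra.IsQuadraticExtension F E]

/-- **The compactified Shimura varieties associated to `𝕍`** (l. 4656–4660 and Def. C.8, l. 4663–4665), over a system `S` of
Shimura varieties associated to `𝕍` (Def. C.6): «The scheme `Sh(𝕍)_K` (for `K` sufficiently small) is quasi-projective and smooth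
over `E` of dimension `n − 1`. It is projective if `d > 1` or `n = 1`. In all cases, we denote by `\overline{Sh}(𝕍)_K` the Baily–Borel
compactification of `Sh(𝕍)_K` over `E`. Then `\overline{Sh}(𝕍)_K ∖ Sh(𝕍)_K` is either empty or consists of isolated singular points. Let
`S̃h(𝕍)_K` be the blow-up of `\overline{Sh}(𝕍)_K` along `\overline{Sh}(𝕍)_K ∖ Sh(𝕍)_K`. If `Sh(𝕍)_K` is proper, then `S̃h(𝕍)_K = Sh(𝕍)_K`.
[…]» — «We call the projective system of schemes `{S̃h(𝕍)_K}_K` over `E` the *compactified Shimura varieties associated to `𝕍`*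
(even when `Sh(𝕍)_K` is already proper).»; §4.2 l. 2060–2064: «Every scheme `Sh(𝕍)_K` is smooth, quasi-projective, and of
dimension `n − 1` over `E` […]. Put `X_K := S̃h(𝕍)_K` for short. Then `{X_K}_K` is a projective system of smooth projective schemes in
`Sch_{/E}` of dimension `n − 1`. For `K' ⊆ K`, we denote the transition morphism by `u^{K'}_K : X_{K'} → X_K` […].»  Mathlib has no
Baily–Borel compactification and no blow-up: `ShBar`, `X`, `blowDown`, `jBar`, `j` are ⟨CARRIER⟩ fields; the printed attributes are
fields on Mathlib / tree vocabulary.  NOT TYPED: «quasi-projective»; «singular» in «isolated singular points»; «generically finite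
dominant»; the isomorphisms (C.3) of l. 4657–4660 (case `d = 1`); Rem. C.9.
[cite: Liu2021, App. C l. 4656–4660, Def. C.8 (l. 4663–4665), §4.2 l. 2060–2064] -/
structure CompactifiedSystem {D : PropC5Data F E} (S : IncoherentShimuraSystem D) : Type 1 where
  /-- ⟨CARRIER⟩ `\overline{Sh}(𝕍)_K`, «the Baily–Borel compactification of `Sh(𝕍)_K` over `E`» (l. 4656). -/
  ShBar : C5.SmallLevel S.K₀ → SchemeOver E
  /-- ⟨CARRIER⟩ the open immersion `Sh(𝕍)_K ↪ \overline{Sh}(𝕍)_K` («compactification»). -/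
  jBar : ∀ K, S.Sh𝕍.obj K ⟶ ShBar K
  /-- `Sh(𝕍)_K ↪ \overline{Sh}(𝕍)_K` is an open immersion. -/
  isOpenImmersion_jBar : ∀ K, IsOpenImmersion (jBar K).left
  /-- «`\overline{Sh}(𝕍)_K ∖ Sh(𝕍)_K` is either empty or consists of isolated […] points» (l. 4656): the boundary, i.e. the
  complement of the image of `Sh(𝕍)_K`, is a discrete subspace («singular» NOT TYPED). -/
  discrete_boundary : ∀ K, DiscreteTopology ↥(Set.range (fun x : ↥(S.Sh𝕍.obj K).left => (jBar K).left.base x))ᶜ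
  /-- ⟨CARRIER⟩ the projective system `K ↦ X_K := S̃h(𝕍)_K`, «the blow-up of `\overline{Sh}(𝕍)_K` along `\overline{Sh}(𝕍)_K ∖ Sh(𝕍)_K`»
  (l. 4656), with its transition morphisms `u^{K'}_K = X.map (K' ⊆ K)` (Def. C.8; §4.2 l. 2062–2064). -/
  X : C5.SmallLevel S.K₀ ⥤ SchemeOver E
  /-- ⟨CARRIER⟩ the blow-down morphism `S̃h(𝕍)_K → \overline{Sh}(𝕍)_K`. -/
  blowDown : ∀ K, X.obj K ⟶ ShBar K
  /-- ⟨CARRIER⟩ the open immersions `Sh(𝕍)_K ↪ S̃h(𝕍)_K = X_K`, compatible with the transition morphisms (a natural transformation). -/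
  j : S.Sh𝕍 ⟶ X
  /-- `Sh(𝕍)_K ↪ X_K → \overline{Sh}(𝕍)_K` is the compactification map. -/
  j_blowDown : ∀ K, j.app K ≫ blowDown K = jBar K
  /-- `Sh(𝕍)_K ↪ X_K` is an open immersion. -/
  isOpenImmersion_j : ∀ K, IsOpenImmersion (j.app K).left
  /-- «If `Sh(𝕍)_K` is proper, then `S̃h(𝕍)_K = Sh(𝕍)_K`» (l. 4656). -/
  isIso_j_of_isProper : ∀ K, IsProper (S.Sh𝕍.obj K).hom → IsIso (j.app K)
  /-- «The scheme `Sh(𝕍)_K (for `K` sufficiently small) is […] smooth over `E` of dimension `n − 1`» (l. 4656; §4.2 l. 2060) —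
  Mathlib `SmoothOfRelativeDimension (n − 1)` of the structure morphism. -/
  smooth_Sh : ∀ K, SmoothOfRelativeDimension (D.n - 1) (S.Sh𝕍.obj K).hom
  /-- «It is projective if `d > 1` or `n = 1`» (l. 4656; `d = [F : ℚ]`) — tree `Motives.IsProjectiveOver`. -/
  projective_Sh_of : (1 < Module.finrank ℚ F ∨ D.n = 1) → ∀ K, IsProjectiveOver (S.Sh𝕍.obj K)
  /-- «`{X_K}_K` is a projective system of smooth projective schemes in `Sch_{/E}` of dimension `n − 1`» (§4.2 l. 2064): smooth of
  relative dimension `n − 1` … -/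
  smooth_X : ∀ K, SmoothOfRelativeDimension (D.n - 1) (X.obj K).hom
  /-- … and projective over `E`. -/
  projective_X : ∀ K, IsProjectiveOver (X.obj K)

end DefC8

/-! ## §4.2 (l. 2053–2074): the standing data of Theorem 4.18 coming from Appendix C -/

section Sec42

variable {F E : Type} [Field F] [NumberField F] [IsTotallyReal F] [Field E] [NumberField E] [Algebra F E]
  [IsTotallyComplex E] [Algebra.IsQuadraticExtension F E]

/-- **The standing data of §4.2 preceding Theorem 4.18** (l. 2053–2074; the printed text is in the module docstring), assembled
from Appendix C, in paper order, over two PARAMETERS: `P5` = typer 3's Prop. C.5 datum (`𝕍` «totally definite incoherent hermitian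
space over `𝔸_E` of rank `n` (Definition C.3)», `𝔾(𝔸_F^∞)`, the fixed nearby data of l. 4624) and ⟨CARRIER⟩ `isotropicAt p` («the
hermitian space `𝕍 ⊗_𝔸 ℚ_p` is isotropic», l. 2055 — the only place §4.2 looks inside the token `𝕍`; both parameters are instantiated on
typer 1/2's REAL hermitian structures in `GlueHermitian.lean`).  Fields: «`n ≥ 2`»; `S` = «the projective system of Shimura
varieties for `𝕍` […] (Definition C.6)», a witness of Prop. C.5; «it is projective if and only if we are in the Compact Case»
(l. 2060; the case condition spelled out, cf. `isProjectiveOver_iff_isCompactCase`); `cpt` = the `X_K := S̃h(𝕍)_K` (Def. C.8) with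
their printed attributes; `alb K` = the Albanese datum `A_K := Alb_{X_K}`, `α_K` (l. 2066–2069, Def. 2.3); ⟨CARRIER⟩ `∇u^{K'}_K`,
the restriction of `u^{K'}_K × u^{K'}_K` (Def. 2.1 (1)); `Alb_{u^{K'}_K} : A_{K'} → A_K` «by the universal property, which
satisfies» the printed identity in its composable reading `Alb_u ∘ α_Y = α_X ∘ ∇u` (READING G3), and «By functoriality, we obtain
a projective system `{A_K}_K`» (`Atr_id`, `Atr_comp`; `albFunctor`).  NOT TYPED: `X_∞`, the pro-object `A_∞`, the Hecke
homomorphism `𝔾(𝔸_F^∞) → Aut_E(A_∞)` (l. 2074; no formula printed).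
[cite: Liu2021, §4.2 l. 2053–2074; Def. 2.1 (1), Def. 2.3; App. C Def. C.3, l. 4624, Def. C.6, Def. C.8] -/
structure Sec42Data (P5 : PropC5Data F E) (isotropicAt : ℕ → Prop) : Type 1 where
  /-- «Let `n ≥ 2` be an integer» (l. 2053). -/
  two_le_n : 2 ≤ P5.n
  /-- `{Sh(𝕍)_K}_K`, «the projective system of Shimura varieties for `𝕍` indexed by sufficiently small open compact subgroups `K`
  of `𝔾(𝔸_F^∞)` (Definition C.6)» (l. 2060) — a witness of Prop. C.5. -/
  S : IncoherentShimuraSystem P5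
  /-- «it is projective if and only if we are in the Compact Case» (l. 2060), the Compact Case being the negation of «`d = 1`, and
  either `n ≥ 3` or `n = 2` and […] `𝕍 ⊗_𝔸 ℚ_p` is isotropic for every rational prime `p`» (l. 2055–2057). -/
  isProjectiveOver_Sh_iff : ∀ K, IsProjectiveOver (S.Sh𝕍.obj K) ↔
    ¬ (Module.finrank ℚ F = 1 ∧ (3 ≤ P5.n ∨ (P5.n = 2 ∧ ∀ p : ℕ, p.Prime → isotropicAt p)))
  /-- `X_K := S̃h(𝕍)_K` (l. 2062) with the printed attributes (Def. C.8, l. 4656–4660, l. 2060–2064). -/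
  cpt : CompactifiedSystem S
  /-- `A_K := Alb_{X_K}` with `α_K : ∇X_K → A_K` (l. 2066–2069; Def. 2.3), for every sufficiently small `K`. -/
  alb : ∀ K : C5.SmallLevel S.K₀, Albanese (cpt.X.obj K)
  /-- ⟨CARRIER⟩ `∇u^{K'}_K : ∇X_{K'} → ∇X_K` for `K' ⊆ K`, the restriction of `u^{K'}_K × u^{K'}_K` (Def. 2.1 (1), l. 1174). -/
  nablaTr : ∀ {K K' : C5.SmallLevel S.K₀}, (K' ⟶ K) → ((alb K').nabla.N ⟶ (alb K).nabla.N)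
  /-- `∇u` is the restriction of `u × u`. -/
  nablaTr_incl : ∀ {K K'} (f : K' ⟶ K), nablaTr f ≫ (alb K).nabla.incl = (alb K').nabla.incl ≫ (cpt.X.map f ⊗ₘ cpt.X.map f)
  /-- `Alb_{u^{K'}_K} : A_{K'} → A_K`, «the induced morphism […] by the universal property» (Def. 2.3, l. 1207). -/
  Atr : ∀ {K K' : C5.SmallLevel S.K₀}, (K' ⟶ K) → ((alb K').Alb ⟶ (alb K).Alb)
  /-- «which satisfies `Alb_u ∘ α_Y = α_X ∘ ∇u`» (READING G3 of the printed «`Alb_u ∘ α_X = α_Y ∘ ∇u`», l. 1207). -/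
  α_Atr : ∀ {K K'} (f : K' ⟶ K), (alb K').α ≫ (Atr f).hom.hom.hom = nablaTr f ≫ (alb K).α
  /-- «By functoriality, we obtain a projective system `{A_K}_K`» (l. 2070): identities … -/
  Atr_id : ∀ K, Atr (𝟙 K) = 𝟙 (alb K).Alb
  /-- … and composition. -/
  Atr_comp : ∀ {K K' K''} (f : K'' ⟶ K') (g : K' ⟶ K), Atr (f ≫ g) = Atr f ≫ Atr g

namespace Sec42Data

variable {P5 : PropC5Data F E} {isotropicAt : ℕ → Prop} (C : Sec42Data P5 isotropicAt)

/-- `𝔾(𝔸_F^∞)` for `𝔾 := U(𝕍)` (l. 2060; App. C l. 4618): typer 3's carrier `PropC5Data.G`. [cite: Liu2021, §4.2 l. 2060] -/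
abbrev G (_C : Sec42Data P5 isotropicAt) : Type := P5.G

/-- The rank `n` of `𝕍` (l. 2053; Def. C.3). [cite: Liu2021, §4.2 l. 2053] -/
abbrev n (_C : Sec42Data P5 isotropicAt) : ℕ := P5.n

/-- **Noncompact Case** (l. 2055): «`d = 1`, and either `n ≥ 3` or `n = 2` and the hermitian space `𝕍 ⊗_𝔸 ℚ_p` is isotropic for
every rational prime `p`» (`d = [F : ℚ]`, l. 1878). [cite: Liu2021, §4.2 l. 2053–2055] -/
def IsNoncompactCase : Prop :=
  Module.finrank ℚ F = 1 ∧ (3 ≤ C.n ∨ (C.n = 2 ∧ ∀ p : ℕ, p.Prime → isotropicAt p))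

/-- **Compact Case** (l. 2057): «if it is not in the Noncompact Case». [cite: Liu2021, §4.2 l. 2057] -/
def IsCompactCase : Prop :=
  ¬ C.IsNoncompactCase

/-- «it is projective if and only if we are in the Compact Case» (l. 2060), restated with the two definitions.
[cite: Liu2021, §4.2 l. 2060] -/
theorem isProjectiveOver_iff_isCompactCase (K : C5.SmallLevel C.S.K₀) :
    IsProjectiveOver (C.S.Sh𝕍.obj K) ↔ C.IsCompactCase :=
  C.isProjectiveOver_Sh_iff K

/-- `X_K := S̃h(𝕍)_K` (l. 2062). [cite: Liu2021, §4.2 l. 2062] -/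
abbrev X (K : C5.SmallLevel C.S.K₀) : SchemeOver E := C.cpt.X.obj K

/-- `A_K := Alb_{X_K}`, an abelian variety over `E` (l. 2066). [cite: Liu2021, §4.2 l. 2066] -/
abbrev A (K : C5.SmallLevel C.S.K₀) : AbelianVariety E := (C.alb K).Alb

/-- `ΔX_{K'} ≫ ∇u^{K'}_K = u^{K'}_K ≫ ΔX_K`: the restriction `∇u` of `u × u` carries the diagonal to the diagonal (Def. 2.1 (1);
from `nablaTr_incl`, the factorisations `diag_incl`, and the fact that the closed immersion `∇X_K ↪ X_K × X_K` is a monomorphism).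
Ours. [cite: Liu2021, Def. 2.1 (1)] -/
theorem diag_nablaTr {K K' : C5.SmallLevel C.S.K₀} (f : K' ⟶ K) :
    (C.alb K').nabla.diag ≫ C.nablaTr f = C.cpt.X.map f ≫ (C.alb K).nabla.diag := by
  haveI : IsClosedImmersion (C.alb K).nabla.incl.left := (C.alb K).nabla.isClosedImmersion_incl
  haveI : Mono (C.alb K).nabla.incl := Over.mono_of_mono_left _
  rw [← cancel_mono (C.alb K).nabla.incl, Category.assoc, C.nablaTr_incl f, ← Category.assoc,
    (C.alb K').nabla.diag_incl, Category.assoc, (C.alb K).nabla.diag_incl]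
  ext <;> simp

/-- **`Alb_{u^{K'}_K}` is «the induced morphism … by the universal property»** (Def. 2.3, l. 1207): the field `Atr f` EQUALS the
homomorphism `Alb_{X_{K'}} → Alb_{X_K}` that the corepresentability of `Alb_{X_{K'}}` attaches to `∇u^{K'}_K ≫ α_{X_K}` — so `Atr` carries
no freedom beyond the printed identity `α_Atr` (READING G3).  Ours, from `uniq`. [cite: Liu2021, Def. 2.3 (l. 1207)] -/
theorem Atr_eq_desc {K K' : C5.SmallLevel C.S.K₀} (f : K' ⟶ K) :
    C.Atr f = (C.alb K').desc (C.nablaTr f ≫ (C.alb K).α) (by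
      rw [← Category.assoc, C.diag_nablaTr f, Category.assoc, (C.alb K).diag_α, MonObj.comp_one]) :=
  (C.alb K').uniq _ _ _ (C.α_Atr f)

/-- «By functoriality, we obtain a projective system `{A_K}_K`» (l. 2070): `K ↦ A_K`, `(K' ⊆ K) ↦ Alb_{u^{K'}_K}`, as a functor
(the system whose limit is the pro-object `A_∞ := lim_K A_K`, l. 2072). [cite: Liu2021, §4.2 l. 2070–2072] -/
def albFunctor : C5.SmallLevel C.S.K₀ ⥤ AbelianVariety E where
  obj K := C.A K
  map f := C.Atr f
  map_id K := C.Atr_id K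
  map_comp f g := C.Atr_comp f g

/-- **`Hom_E(A_K, B)_ℚ := ℚ ⊗_ℤ Hom_E(A_K, B)`** for an abelian variety `B` over `E` — with `B = A_μ` the `E`-RATIONAL Hom group of
Thm. 4.18 (1), l. 2239 (tree `Motives.AbelianVariety`: morphisms over `E`, additive by Mumford §19). [cite: Liu2021, Thm. 4.18 (1) l. 2239] -/
abbrev HomQ (K : C5.SmallLevel C.S.K₀) (B : AbelianVariety E) : Type := ℚ ⊗[ℤ] (C.A K ⟶ B)

/-- Pull-back `Hom_E(A_K, B)_ℚ → Hom_E(A_{K'}, B)_ℚ` along `Alb_{u^{K'}_K} : A_{K'} → A_K` for `K' ⊆ K`: the maps of the inductive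
system `{Hom_E(A_K, A_μ)_ℚ}_K` whose colimit is `Hom_E(A_∞, A_μ)_ℚ`, `A_∞ := lim_K A_K` (l. 2072; READING G2).
[cite: Liu2021, §4.2 l. 2070–2072] -/
def HomQ.pull {K K' : C5.SmallLevel C.S.K₀} (f : K' ⟶ K) (B : AbelianVariety E) : C.HomQ K B →ₗ[ℤ] C.HomQ K' B :=
  (Preadditive.leftComp B (C.Atr f)).toIntLinearMap.lTensor ℚ

/-- On pure tensors the pull-back is `q ⊗ φ ↦ q ⊗ (Alb_{u^{K'}_K} ≫ φ)`. Unfolding, ours. [cite: Liu2021, §4.2 l. 2070–2072] -/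
@[simp] theorem HomQ.pull_tmul {K K' : C5.SmallLevel C.S.K₀} (f : K' ⟶ K) (B : AbelianVariety E) (q : ℚ) (φ : C.A K ⟶ B) :
    HomQ.pull C f B (q ⊗ₜ φ) = q ⊗ₜ (C.Atr f ≫ φ) :=
  rfl

/-- The level of `Hom_E(A_K, A_μ)_ℚ` for an ARBITRARY subgroup `K ≤ 𝔾(𝔸_F^∞)` (`Thm418Data.HomK` is indexed by all subgroups,
its statement only uses sufficiently small open compact ones): `K ⊓ K₀` if `K` is open compact (an open compact subgroup
`⊆ K₀`; equal to `K` when `K ⊆ K₀`, `coe_levelOf`), the threshold `K₀` otherwise (a value never used).  Bookkeeping, ours.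
[cite: Liu2021, Thm. 4.18 (1) l. 2239] -/
def levelOf (K : Subgroup C.G) : C5.SmallLevel C.S.K₀ := by
  classical
  exact if h : IsOpenCompact K then
    ⟨⟨K ⊓ C.S.K₀.1, by
        refine ⟨?_, ?_⟩
        · simpa only [Subgroup.coe_inf] using h.1.inter C.S.K₀.2.1
        · simpa only [Subgroup.coe_inf] using
            C.S.K₀.2.2.inter_left (Subgroup.isClosed_of_isOpen K h.1)⟩,
      (inf_le_right : K ⊓ C.S.K₀.1 ≤ C.S.K₀.1)⟩
  else ⟨C.S.K₀, le_rfl⟩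

/-- For a sufficiently small open compact `K` the level of `K` is `K` itself. [cite: Liu2021, Thm. 4.18 (1) l. 2239] -/
theorem coe_levelOf {K : Subgroup C.G} (hK : IsOpenCompact K) (hle : K ≤ C.S.K₀.1) :
    ((C.levelOf K).1 : Subgroup C.G) = K := by
  classical
  simp only [levelOf, dif_pos hK]
  exact inf_eq_left.2 hle

end Sec42Data

/-! ## The bridge to `Thm418Data` -/

/-- **The data of Theorem 4.18 NOT coming from Appendix C**, over an Appendix-C datum `C` (in the order of `Thm418Data`): the
collections `ε` and `e ↦ (e Nm)_v` (Def. 4.11 / 4.12), the characters `χ` (Def. 4.11), the REAL character `μ` with its two printed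
hypotheses (Def. 4.1, 4.3 (1), 4.16), the objects `D_μ = (A_μ, i_μ, λ_μ, r_μ) ∈ 𝒜(μ)` (Def. 4.5 (2)–(3)) now with their FIRST
COMPONENT «`A_μ` is an abelian variety over `E`» (Def. 4.5 (2), first bullet, l. 1944) as a REAL abelian variety over `E` (the
components `i_μ`, `λ_μ`, `r_μ` are not typed here), the modules `ω(μ, ε, χ)` and `Ω(μ)` with their `𝔾(𝔸_F^∞)`-actions (Def. 4.11,
Def. 4.16 — `𝔾(𝔸_F^∞) = C.G`), and the canonical maps `Hom_E(A_K, A_μ)_ℚ → Ω(μ)` (l. 2070–2072 with Def. 4.16 / Rem. 4.17) on the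
now REAL groups `ℚ ⊗_ℤ Hom_E(A_K, A_μ)`, with their compatibility with pull-back along `Alb_{u^{K'}_K}` (READING G2: the printed map is
`Hom_E(A_K, A_μ)_ℚ → Hom_E(A_∞, A_μ)_ℚ = colim_K Hom_E(A_K, A_μ)_ℚ → Ω(μ)`).  ⟨CARRIER⟩ marks as in `Thm418Data`.  The
instance fields are NOT registered as global instances here (they are, on `toThm418Data C R`, by `Thm418AsPrinted.lean`); a
consumer working with `R.omega`/`R.Ω` directly uses `attribute [local instance]`.
[cite: Liu2021, Def. 4.5 (2), Def. 4.11, Def. 4.12, Def. 4.16, Rem. 4.17, §4.2 l. 2070–2072] -/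
structure Thm418Rest {P5 : PropC5Data F E} {isotropicAt : ℕ → Prop} (C : Sec42Data P5 isotropicAt) : Type 1 where
  /-- ⟨CARRIER⟩ as `Thm418Data.Eps` (Def. 4.11, second bullet). -/
  Eps : Type
  /-- ⟨CARRIER⟩ as `Thm418Data.epsOf` (Def. 4.12, first bullet). -/
  epsOf : E → Eps
  /-- ⟨CARRIER⟩ as `Thm418Data.Chi` (Def. 4.11, third bullet). -/
  Chi : Type
  /-- REAL, as `Thm418Data.μ` (Def. 4.16). -/
  μ : IdeleClassGroup E →ₜ* Circle
  /-- as `Thm418Data.isConjugateSymplectic` (Def. 4.1). -/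
  isConjugateSymplectic : letI : IsCMField E := isCMField F E; IdeleClassGroup.IsConjugateSymplectic E μ
  /-- as `Thm418Data.hasWeight_one` (Def. 4.3 (1)). -/
  hasWeight_one : letI : IsCMField E := isCMField F E; IdeleClassGroup.HasWeight E μ 1
  /-- ⟨CARRIER⟩ as `Thm418Data.Obj`: the objects `D_μ = (A_μ, i_μ, λ_μ, r_μ)` of `𝒜(μ)` (Def. 4.5 (2)–(3)). -/
  Obj : Type
  /-- `A_μ`, «an abelian variety over `E`» (Def. 4.5 (2), first bullet, l. 1944): the first component of the object `D_μ`, REAL. -/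
  Aμ : Obj → AbelianVariety E
  /-- ⟨CARRIER⟩ as `Thm418Data.omega` (Def. 4.11). -/
  omega : Eps → Chi → Type
  [instAddCommGroupOmega : ∀ ε χ, AddCommGroup (omega ε χ)]
  [instModuleOmega : ∀ ε χ, Module ℂ (omega ε χ)]
  /-- ⟨CARRIER⟩ as `Thm418Data.rho`, on `𝔾(𝔸_F^∞) = C.G`. -/
  rho : ∀ ε χ, Representation ℂ C.G (omega ε χ)
  /-- ⟨CARRIER⟩ as `Thm418Data.Ω` (Def. 4.16). -/
  Ω : Type
  [instAddCommGroupΩ : AddCommGroup Ω]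
  [instModuleΩ : Module (fieldOfValues E μ) Ω]
  /-- ⟨CARRIER⟩ as `Thm418Data.rhoΩ` («`𝔾(𝔸_F^∞)` acts `M_μ`-linearly via its action on `A_∞`», l. 2219, i.e. via the Hecke homomorphism
  of l. 2074, not typed). -/
  rhoΩ : Representation (fieldOfValues E μ) C.G Ω
  /-- ⟨CARRIER⟩ the canonical map `Hom_E(A_K, A_μ)_ℚ → Hom_E(A_∞, A_μ)_ℚ → Ω(μ)` (l. 2070–2072, Def. 4.16, Rem. 4.17), on the REAL group
  `ℚ ⊗_ℤ Hom_E(A_K, A_μ)`, for every sufficiently small `K`. -/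
  res : ∀ (K : C5.SmallLevel C.S.K₀) (D : Obj), C.HomQ K (Aμ D) →+ Ω
  /-- READING G2: compatibility with the inductive system, `res_{K'} ∘ (Alb_{u^{K'}_K})^* = res_K` for `K' ⊆ K`. -/
  res_pull : ∀ {K K' : C5.SmallLevel C.S.K₀} (f : K' ⟶ K) (D : Obj) (φ : C.HomQ K (Aμ D)),
    res K' D (Sec42Data.HomQ.pull C f (Aμ D) φ) = res K D φ

/-- **How Appendix C feeds the data of Theorem 4.18**: the `Thm418Data` whose carriers `𝕍` and `G = 𝔾(𝔸_F^∞)` are those of the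
Appendix-C datum (Def. C.3, l. 4618; typer 3's `PropC5Data`), whose `Hom_E(A_K, A_μ)_ℚ` is the REAL group
`ℚ ⊗_ℤ Hom_E(Alb_{X_K}, A_μ)` of §4.2 (`X_K = S̃h(𝕍)_K`, Def. C.8; `A_K = Alb_{X_K}`, Def. 2.3) at the level `levelOf K` (`= K` for the
sufficiently small open compact `K` of item (1)), and whose remaining fields are `R`'s. [cite: Liu2021, §4.2 l. 2053–2074 and Thm. 4.18] -/
def toThm418Data {P5 : PropC5Data F E} {isotropicAt : ℕ → Prop} (C : Sec42Data P5 isotropicAt) (R : Thm418Rest C) :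
    Thm418Data F E where
  n := P5.n
  two_le_n := C.two_le_n
  𝕍 := P5.𝕍
  G := C.G
  Eps := R.Eps
  epsOf := R.epsOf
  Chi := R.Chi
  μ := R.μ
  isConjugateSymplectic := R.isConjugateSymplectic
  hasWeight_one := R.hasWeight_one
  Obj := R.Obj
  omega := R.omega
  instAddCommGroupOmega := R.instAddCommGroupOmega
  instModuleOmega := R.instModuleOmega
  rho := R.rho
  Ω := R.Ω
  instAddCommGroupΩ := R.instAddCommGroupΩ
  instModuleΩ := R.instModuleΩ
  rhoΩ := R.rhoΩ
  HomK K D := C.HomQ (C.levelOf K) (R.Aμ D)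
  res K D := R.res (C.levelOf K) D

/-- **[Liu2021, Thm. 4.18] AS PRINTED for a datum presented through Appendix C**: `Thm418AsPrinted (toThm418Data C R)`.  A consumer
takes `(h : Thm418AsPrintedC C R)` for ITS OWN `C`, `R`; nothing is asserted here. [cite: Liu2021, Thm. 4.18] -/
abbrev Thm418AsPrintedC {P5 : PropC5Data F E} {isotropicAt : ℕ → Prop} (C : Sec42Data P5 isotropicAt) (R : Thm418Rest C) :
    Prop :=
  Thm418AsPrinted (toThm418Data C R)

namespace Sec42Data

variable {P5 : PropC5Data F E} {isotropicAt : ℕ → Prop} (C : Sec42Data P5 isotropicAt) (R : Thm418Rest C)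

/-- Dot-notation alias `C.toThm418Data R`. [cite: Liu2021, §4.2 and Thm. 4.18] -/
protected abbrev toThm418Data : Thm418Data F E := AppendixC.toThm418Data C R

/-- The group of `toThm418Data` is `𝔾(𝔸_F^∞)` of Appendix C (by `rfl`). [cite: Liu2021, §4.2 l. 2060] -/
theorem toThm418Data_G : (toThm418Data C R).G = C.G := rfl

/-- `Hom_E(A_K, A_μ)_ℚ` of `toThm418Data` is the REAL group `ℚ ⊗_ℤ Hom_E(A_{levelOf K}, A_μ)` (by `rfl`). [cite: Liu2021, Thm. 4.18 (1)] -/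
theorem toThm418Data_HomK (K : Subgroup C.G) (D : R.Obj) :
    (toThm418Data C R).HomK K D = C.HomQ (C.levelOf K) (R.Aμ D) := rfl

end Sec42Data

end Sec42

end Literature.NumberTheory.Automorphic.Liu2021.AppendixC

end
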